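import Literature.NumberTheory.EllipticCurves.FineSelmerUpstairsSubgroupModelProofs
import Literature.NumberTheory.EllipticCurves.FineSelmerRestrictionDescentProofs
import Literature.NumberTheory.EllipticCurves.GoodReductionUnramifiedProofs
import HarnessLib

/-!
# Statement (A) UPSTAIRS in the subgroup model over a totally complex `L` whose Galois group acts on `E[p]`
# UNIPOTENTLY of level two, from Iwasawa's classical `μ = 0` of `L` itself (no ascent; proved, no named fact)

`Proofs`-style file (theorems only: no definition, no named fact, no `sorry`) in topic `NumberTheory/EllipticCurves`
(namespace `Literature.NumberTheory.EllipticCurves.FineSelmerUpstairs`), written by the prover seat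
`cruxlead-stmt-BirchSwinnertonDyer-19573-w2` GEN 6 (cell `bsd-2adic`; `--supports` stmt-BirchSwinnertonDyer-19573, crux 202
`OrdKatoHalfAtTwoIso`; sequel of `FineSelmerUpstairsSubgroupModelProofs.lean` and `FineSelmerLimThm35AtTwoUpstairsProofs.lean`).
Closes nothing; Conjecture A is proved for no curve unconditionally; BSD is not proved by any of this.

WHY. The discharged Lim 2017 Thm. 3.5 at `p = 2` (`Lim2017.thm35_at_two_upstairs_…_holds`) takes Iwasawa's `μ₂ = 0` for the
cyclotomic `ℤ₂`-extension of the DODECIC field `ℚ(E[2], √−1)` (on the `S₃` cell). Lim's printed theorem also accepts any `L` such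
that `F(μ_{2p}, E[p])` lies in a finite `p`-extension of `L` — e.g. the SEXTIC `ℚ(P, √−1)` of ONE `2`-torsion point — but there the
printed proof ASCENDS `μ = 0` along the `p`-extension (Iwasawa 1973, Thm. 2/3; totally imaginary base), which the tree does not hold.
As for the downstairs `L`-form (`FineSelmerPExtensionDescentProofs`, bsd-potss-rkm g33: «the ascent is not needed: `Gal(ℚ(E[p])/L)` is a
`p`-GROUP, so `E[p]` is unipotent of level two over `L`»), the ascent is replaced by a ONE-STEP DÉVISSAGE over `L` itself
(`FineSelmerDevissage.finite_fineSelmerInfty_of_extension` along a flag `0 ⊂ C ⊂ E[p]` fixed by `Γ_L`), run here at ANY prime over a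
TOTALLY COMPLEX base (the tree's `FineSelmerRestrictionDescent.finite_fineSelmerInfty_of_unipotent_restrict` hard-codes `p` odd, used
only for the scope binder of the character form of `μ = 0` and for its final restriction step, which is not taken here).

* §1 (any number field `K`, any normal `H ≤ Γ_K`, any `M`): `resOfLe_decompositionSubgroup_eq_zero_of_forall_decomp` — a class whose
  conjugates all die on the chosen `H ⊓ D_v` dies on `H ⊓ D_𝔓` for EVERY maximal `𝔓 ⊂ \bar ℤ_K` (the finite-place content of
  `resOfLe_decompositionSubgroup_eq_zero_of_mem_strictSelmerGroupOver_fineData`, stated from the local hypotheses alone so that it serves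
  the relaxed-at-`∞` groups too).
* §2 (any TOTALLY COMPLEX number field `F`, any `p`, any finite discrete `p`-primary `Γ_F`-module `M` unramified outside a finite set, any
  flag `C ≤ M` with `Γ_F` fixing `C` pointwise and acting trivially on `M/C`): **`finite_fineSelmerInfty_of_unipotent_of_isTotallyComplex`**
  — `Sel₀(F_∞, M)` is finite when `ClassicalMuVanishes κ_F` (cyclotomic `κ_F`): the discharged character form of `μ = 0`
  (`ClassicalMuVanishesUnramifiedClasses.classicalMuVanishes_finite_unramifiedClasses_holds`, branch «`IsTotallyComplex`») for the trivial
  modules `C` and `M/C`, then the dévissage. Verbatim the `F`-half of `finite_fineSelmerInfty_of_unipotent_restrict`.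
* §3 (any number field `K`, `E = W/K` elliptic, `p`, `L/K` finite totally complex, `C ≤ E[p]` fixed pointwise by `res(Γ_L)` with trivial
  action on `E[p]/C`, `κ_L` cyclotomic with `μ = 0`): **`finite_primewiseFine_pTorsion_galImage_of_unipotent`** — in the subgroup model
  `H¹(galImage(ker κ_L), E[p^∞])` the classes killed by `p` that die on `galImage(ker κ_L) ⊓ D_𝔓` for every maximal `𝔓` form a FINITE
  set (no normality of `galImage(ker κ_L)` in `Γ_K` is needed in this prime-wise form): §2 over `L` for `E_L[p]` (unramified outside
  `{v ∣ p} ∪ {bad v}`, `smul_geomTorsion_eq_of_mem_inertia`; the flag transported along `torsionBaseChangeEquiv`) ⇒ `Sel₀(L_∞, E_L[p])` finite ⇒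
  `Sel₀(L_∞, E_L[p^∞])[p]` finite (`FineSelmerCoefficientMap.finite_fineSelmerInfty_pTorsion_of_finite_torsion_of_forall_infinitePlace`) ⇒
  transport along `BaseChangeModel.subgroupModelIso` with `FineBaseChangeModel.mem_fineSelmerInfty_of_forall_prime_subgroupModelIso`.

References: [Lim2017FineSelmer] M. F. Lim, Asian J. Math. 21 (2017) = arXiv:1306.2047, §3 Thm. 3.5 (hypothesis «`F(μ_{2p}, T/𝔪T)`
contained in a finite `p`-extension of `L`»), Lemma 3.2, proof of Thm. 3.1; [Iwasawa1973MuInvariants] Thm. 2/3 (the ascent, NOT used);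
[CoatesSujatha2005] §3 Thm. 3.4, Cor. 3.5/3.6 (proofs); [SerreLocalFields1979] IX §1; [SilvermanAEC2009] VII.4.1, VIII.§1;
[SerreGaloisCohomology1997] I.§2.4–2.5, I.§5.8, II.§1.1; [Lang1990] Ch. 5 §§1–4.
-/

set_option autoImplicit false

noncomputable section

open scoped Classical Pointwise

namespace Literature.NumberTheory.EllipticCurves.FineSelmerUpstairs

open NumberField IsDedekindDomain Field _root_.WeierstrassCurve
open Literature.NumberTheory.EllipticCurves Literature.NumberTheory.EllipticCurves.GreenbergSelmer
  Literature.NumberTheory.EllipticCurves.GreenbergVatsal2000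
  Literature.NumberTheory.EllipticCurves.FineSelmerTrivialisingRestriction
  Literature.NumberTheory.EllipticCurves.FineSelmerCoefficientMap
  Literature.NumberTheory.EllipticCurves.FineSelmerDevissage
  Literature.NumberTheory.EllipticCurves.FineSelmerRestrictionDescent
  Literature.NumberTheory.GaloisRepresentations Literature.NumberTheory.IwasawaTheory

/-! ## §1 Prime-wise vanishing from the vanishing at the chosen decomposition groups -/

section Primewise

variable {K : Type} [Field K] [NumberField K]
variable {M : Type} [AddCommGroup M] [DistribMulAction (absoluteGaloisGroup K) M] [TopologicalSpace M]
  [DiscreteTopology M]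

/-- **A class all of whose conjugates die on the chosen `H ⊓ D_v` dies on `H ⊓ D_𝔓` for EVERY maximal ideal `𝔓 ⊂ \bar ℤ_K`**
(generic normal `H ≤ Γ_K`; only the finite places enter): `D_𝔓 = g D_v g⁻¹` for the chosen `D_v` above `v = 𝔓 ∩ 𝓞_K`
(`exists_conj_mem_decomp_of_mem_decompositionSubgroup`), the hypothesis for `conj_{g⁻¹} [z]` at `v` gives `g⁻¹ • z(g y g⁻¹) = y • a − a` on
`H ⊓ D_v`, whence `z(x) = x • (g • a) − g • a` on `H ⊓ D_𝔓`. [cite: CoatesSujatha2005, §3 (Lemma 3.3: locally trivial at every place)]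
[cite: SerreGaloisCohomology1997, I.§2.5] -/
theorem resOfLe_decompositionSubgroup_eq_zero_of_forall_decomp (H : Subgroup (absoluteGaloisGroup K)) [H.Normal]
    {c : subgroupH1 H M}
    (hloc : ∀ (v : HeightOneSpectrum (𝓞 K)) (σ : absoluteGaloisGroup K),
      resOfLe M (inf_le_left : H ⊓ decomp v ≤ H) (conjH1 H M σ c) = 0)
    (𝔓 : Ideal (absIntegers (𝓞 K) K)) [𝔓.IsMaximal] :
    resOfLe M (inf_le_left : H ⊓ 𝔓.decompositionSubgroup (absoluteGaloisGroup K) ≤ H) c = 0 := by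
  obtain ⟨v, g, hg⟩ := exists_conj_mem_decomp_of_mem_decompositionSubgroup 𝔓
  obtain ⟨z, rfl⟩ := oneCocycleClass_surjective _ c
  obtain ⟨a, ha⟩ := (CocycleCriteria.conjH1_oneCocycleClass_mem_ker_resOfLe_iff
    (inf_le_left : H ⊓ decomp v ≤ H) g⁻¹ z).1 (hloc v g⁻¹)
  refine (CocycleCriteria.resOfLe_oneCocycleClass_eq_zero_iff _ z).2 ⟨g • a, fun x ↦ ?_⟩
  obtain ⟨hxH, hxD⟩ := Subgroup.mem_inf.1 x.2
  have hyD : g⁻¹ * (x : absoluteGaloisGroup K) * g ∈ decomp v := hg _ hxD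
  have hyH : g⁻¹ * (x : absoluteGaloisGroup K) * g ∈ H := by
    simpa only [inv_inv] using (inferInstance : H.Normal).conj_mem _ hxH g⁻¹
  have h := ha ⟨g⁻¹ * (x : absoluteGaloisGroup K) * g, Subgroup.mem_inf.2 ⟨hyH, hyD⟩⟩
  have hconj : subgroupConj H g⁻¹
      (Subgroup.inclusion (inf_le_left : H ⊓ decomp v ≤ H)
        ⟨g⁻¹ * (x : absoluteGaloisGroup K) * g, Subgroup.mem_inf.2 ⟨hyH, hyD⟩⟩) =
        Subgroup.inclusion
          (inf_le_left : H ⊓ 𝔓.decompositionSubgroup (absoluteGaloisGroup K) ≤ H) x := by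
    apply Subtype.ext
    simp only [subgroupConj_apply_coe, Subgroup.coe_inclusion, inv_inv]
    group
  rw [hconj] at h
  have h2 : z.1 (Subgroup.inclusion
      (inf_le_left : H ⊓ 𝔓.decompositionSubgroup (absoluteGaloisGroup K) ≤ H) x) =
        g • ((g⁻¹ * (x : absoluteGaloisGroup K) * g) • a - a) := by
    rw [← h, smul_inv_smul]
  rw [h2, smul_sub, smul_smul, ← mul_assoc, ← mul_assoc, mul_inv_cancel, one_mul, mul_smul]

end Primewise

/-! ## §2 Dévissage over a totally complex base along a `Γ_F`-fixed flag `C ≤ M` -/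

section Unipotent

variable {F : Type} [Field F] [NumberField F] {p : ℕ} [Fact p.Prime]
variable {M : Type} [AddCommGroup M] [DistribMulAction (absoluteGaloisGroup F) M] [TopologicalSpace M] [DiscreteTopology M]

/-- **`Sel₀(F_∞, M)` is finite for `M` UNIPOTENT OF LEVEL TWO over a TOTALLY COMPLEX `F` with `μ(F^{cyc}) = 0`** (any prime `p`). Data: `F`
a totally complex number field, `κ_F` its cyclotomic `ℤ_p`-extension with Iwasawa's classical `μ = 0` (growth form), `M` a finite discrete
`p`-primary `Γ_F`-module unramified outside a finite set `S` of finite places, `C ≤ M` a subgroup FIXED POINTWISE by `Γ_F` with `Γ_F` acting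
TRIVIALLY on `M/C`. Then the fine Selmer group of `M` over `F_∞` is finite: the character form of Iwasawa's `μ = 0` (the DISCHARGED tree
fact `ClassicalMuVanishesUnramifiedClasses.classicalMuVanishes_finite_unramifiedClasses_holds`, branch «`IsTotallyComplex F`») makes the
everywhere-unramified homomorphisms `Hom(Gal(F̄/F_∞), C; ∅)` and `Hom(Gal(F̄/F_∞), M/C; ∅)` finite, and the dévissage
`FineSelmerDevissage.finite_fineSelmerInfty_of_extension` (with `N = Γ_F`) concludes. Verbatim the `F`-half of the tree's
`finite_fineSelmerInfty_of_unipotent_restrict` (there `p` odd). [cite: CoatesSujatha2005, §3 (proofs of Thm. 3.4 and Cor. 3.5/3.6)]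
[cite: Lim2017FineSelmer, §3 Thm. 3.5 (proof)] [cite: Lang1990, Ch. 5 §4] -/
theorem finite_fineSelmerInfty_of_unipotent_of_isTotallyComplex [Finite M]
    (hF : NumberField.IsTotallyComplex F)
    (κF : ZpExtension F p) (hκF : κF.IsCyclotomic) (hμ : ClassicalMuVanishes κF)
    (hcardM : ∃ k : ℕ, Nat.card M = p ^ k)
    (S : Set (HeightOneSpectrum (𝓞 F))) (hS : S.Finite)
    (hunr : ∀ v ∉ S, ∀ 𝔓 ∈ v.primesAbove, ∀ σ ∈ 𝔓.inertia (absoluteGaloisGroup F), ∀ m : M, σ • m = m)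
    (C : AddSubgroup M)
    (hC1 : ∀ (τ : absoluteGaloisGroup F) (m : M), m ∈ C → τ • m = m)
    (hC2 : ∀ (τ : absoluteGaloisGroup F) (m : M), τ • m - m ∈ C) :
    (fineSelmerInfty M κF : Set (subgroupH1 κF.kerSubgroup M)).Finite := by
  have hpr : p.Prime := Fact.out
  have hchar := ClassicalMuVanishesUnramifiedClasses.classicalMuVanishes_finite_unramifiedClasses_holds
  -- cards of `C` and `M ⧸ C`
  have hcardC : ∃ k : ℕ, Nat.card C = p ^ k := by
    obtain ⟨k, hk⟩ := hcardM
    have hdvd : Nat.card C ∣ p ^ k := hk ▸ AddSubgroup.card_addSubgroup_dvd_card C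
    obtain ⟨j, -, hj⟩ := (Nat.dvd_prime_pow hpr).1 hdvd
    exact ⟨j, hj⟩
  have hcardQ : ∃ k : ℕ, Nat.card (M ⧸ C) = p ^ k := by
    obtain ⟨k, hk⟩ := hcardM
    have hdvd : Nat.card (M ⧸ C) ∣ p ^ k := hk ▸ AddSubgroup.card_quotient_dvd_card C
    obtain ⟨j, -, hj⟩ := (Nat.dvd_prime_pow hpr).1 hdvd
    exact ⟨j, hj⟩
  -- the quotient `Γ_F`-module `M ⧸ C` (trivial action)
  have hCstab : ∀ (σ : absoluteGaloisGroup F) (x : M), x ∈ C → σ • x ∈ C := fun σ x hx ↦ by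
    rw [hC1 σ x hx]; exact hx
  letI instQ : DistribMulAction (absoluteGaloisGroup F) (M ⧸ C) :=
    { smul := fun σ ↦ QuotientAddGroup.map C C (DistribSMul.toAddMonoidHom M σ)
        (fun x hx ↦ AddSubgroup.mem_comap.2 (hCstab σ x hx))
      one_smul := fun q ↦ QuotientAddGroup.induction_on q fun m ↦ by
        change QuotientAddGroup.map C C (DistribSMul.toAddMonoidHom M (1 : absoluteGaloisGroup F)) _
          (m : M ⧸ C) = _
        rw [QuotientAddGroup.map_mk, DistribSMul.toAddMonoidHom_apply, one_smul]
      mul_smul := fun σ τ q ↦ QuotientAddGroup.induction_on q fun m ↦ by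
        change QuotientAddGroup.map C C (DistribSMul.toAddMonoidHom M (σ * τ)) _ (m : M ⧸ C) =
          QuotientAddGroup.map C C (DistribSMul.toAddMonoidHom M σ) _
            (QuotientAddGroup.map C C (DistribSMul.toAddMonoidHom M τ) _ (m : M ⧸ C))
        rw [QuotientAddGroup.map_mk, QuotientAddGroup.map_mk, QuotientAddGroup.map_mk,
          DistribSMul.toAddMonoidHom_apply, DistribSMul.toAddMonoidHom_apply,
          DistribSMul.toAddMonoidHom_apply, mul_smul]
      smul_zero := fun σ ↦ map_zero _
      smul_add := fun σ a b ↦ map_add _ a b }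
  letI : TopologicalSpace (M ⧸ C) := ⊥
  haveI : DiscreteTopology (M ⧸ C) := ⟨rfl⟩
  have hsmulQ : ∀ (σ : absoluteGaloisGroup F) (m : M), σ • (m : M ⧸ C) = ((σ • m : M) : M ⧸ C) :=
    fun σ m ↦ rfl
  let π : M →+ M ⧸ C := QuotientAddGroup.mk' C
  have hπ : ∀ (σ : absoluteGaloisGroup F) (m : M), π (σ • m) = σ • π m := fun σ m ↦ rfl
  have hπker : ∀ m : M, π m = 0 ↔ m ∈ C := fun m ↦ QuotientAddGroup.eq_zero_iff m
  have htrivQ : ∀ (σ : absoluteGaloisGroup F) (q : M ⧸ C), σ • q = q := fun σ q ↦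
    QuotientAddGroup.induction_on q fun m ↦ by
      rw [hsmulQ, QuotientAddGroup.eq_iff_sub_mem]
      exact hC2 σ m
  have hNQ : ∀ σ ∈ (⊤ : Subgroup (absoluteGaloisGroup F)), ∀ q : M ⧸ C, σ • q = q :=
    fun σ _ q ↦ htrivQ σ q
  have hNC : ∀ σ ∈ (⊤ : Subgroup (absoluteGaloisGroup F)), ∀ m : M, π m = 0 → σ • m = m :=
    fun σ _ m hm ↦ hC1 σ m ((hπker m).1 hm)
  haveI : (⊤ : Subgroup (absoluteGaloisGroup F)).Normal := ⟨fun _ _ _ ↦ Subgroup.mem_top _⟩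
  have hNopen : IsOpen ((⊤ : Subgroup (absoluteGaloisGroup F)) : Set (absoluteGaloisGroup F)) := by
    rw [Subgroup.coe_top]; exact isOpen_univ
  -- the two finiteness inputs, from the character form of `μ = 0` over `F`
  have hQfin : (unramifiedHoms ((⊤ : Subgroup (absoluteGaloisGroup F)) ⊓ κF.kerSubgroup) (M ⧸ C)
      (∅ : Set (HeightOneSpectrum (𝓞 F)))).Finite :=
    finite_unramifiedHoms_of_finite_unramifiedClasses htrivQ κF
      (hchar F p κF (Or.inr hF) hμ (M ⧸ C) hcardQ htrivQ)
  have hCfin : {f ∈ unramifiedHoms ((⊤ : Subgroup (absoluteGaloisGroup F)) ⊓ κF.kerSubgroup) M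
      (∅ : Set (HeightOneSpectrum (𝓞 F))) | ∀ u, π (f u) = 0}.Finite := by
    letI instC : DistribMulAction (absoluteGaloisGroup F) C :=
      { smul := fun _ c ↦ c
        one_smul := fun _ ↦ rfl
        mul_smul := fun _ _ _ ↦ rfl
        smul_zero := fun _ ↦ rfl
        smul_add := fun _ _ _ ↦ rfl }
    have htrivC : ∀ (σ : absoluteGaloisGroup F) (c : C), σ • c = c := fun _ _ ↦ rfl
    have h := finite_unramifiedHoms_of_finite_unramifiedClasses htrivC κF
      (hchar F p κF (Or.inr hF) hμ C hcardC htrivC)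
    refine (h.image fun (f' : ↥((⊤ : Subgroup (absoluteGaloisGroup F)) ⊓ κF.kerSubgroup) → C) u ↦
      (f' u : M)).subset ?_
    rintro f ⟨hf, hfπ⟩
    have hfC : ∀ u, f u ∈ C := fun u ↦ (hπker _).1 (hfπ u)
    refine ⟨fun u ↦ ⟨f u, hfC u⟩, ⟨hf.1.subtype_mk _, fun σ τ ↦ Subtype.ext (hf.2.1 σ τ),
      fun v hv 𝔓 h𝔓 σ hσ ↦ Subtype.ext (hf.2.2 v hv 𝔓 h𝔓 σ hσ)⟩, rfl⟩
  exact finite_fineSelmerInfty_of_extension κF hκF π hπ ⊤ hNopen hNQ hNC S hS hunr hQfin hCfin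

end Unipotent

/-! ## §3 Upstairs in the subgroup model, prime-wise form, along a unipotent flag on `E[p]` -/

section UpstairsUnipotent

variable {K : Type} [Field K] [NumberField K] (W : WeierstrassCurve K) [W.IsElliptic] {p : ℕ} [Fact p.Prime]
  {L : Type} [Field L] [NumberField L] [Algebra K L] [Algebra.IsAlgebraic K L]

omit [NumberField K] in
/-- **Statement (A) UPSTAIRS in the subgroup model, PRIME-WISE form, for `E[p]` unipotent of level two over a totally complex `L`.**
`K` a number field, `E = W/K` elliptic, `p` a prime, `L ⊇ K` finite and TOTALLY COMPLEX, `C ≤ E[p]` a subgroup FIXED pointwise by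
`res(Γ_L)` with `res(Γ_L)` acting trivially on `E[p]/C` (e.g. `C = ℤ·P'` for a non-zero `2`-torsion point `P'` fixed by `res(Γ_L)`, `p = 2`),
`κ_L` a cyclotomic `ℤ_p`-extension of `L` with Iwasawa's classical `μ = 0`. Then in `H¹(galImage(ker κ_L), E[p^∞])` (`galImage(ker κ_L) =
res(Gal(L̄/L_∞)) ≤ Γ_K`, NOT assumed normal) the classes killed by `p` which die on `galImage(ker κ_L) ⊓ D_𝔓` for every maximal ideal
`𝔓 ⊂ \bar ℤ_K` form a FINITE set. §2 over `L` for `E_L[p]` (unramified outside `{v ∣ p} ∪ {bad v}`, AEC VII.4.1; the flag transported along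
`torsionBaseChangeEquiv`) ⇒ `Sel₀(L_∞, E_L[p])` finite ⇒ `Sel₀(L_∞, E_L[p^∞])[p]` finite (complex places impose nothing) ⇒ transport along
`BaseChangeModel.subgroupModelIso` and its prime-wise description of the fine classes.
[cite: Lim2017FineSelmer, §3 Thm. 3.5 and proof of Thm. 3.1 (arXiv:1306.2047 pp. 6–7)] [cite: CoatesSujatha2005, §3 Thm. 3.4 (proof), Lemma 3.3]
[cite: SilvermanAEC2009, Prop. VII.4.1(a)] -/
theorem finite_primewiseFine_pTorsion_galImage_of_unipotent
    (hL : ∀ w : InfinitePlace L, w.IsComplex)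
    (C : AddSubgroup (geomTorsion W (p : ℤ)))
    (hC1 : ∀ (σ : absoluteGaloisGroup L) (P : geomTorsion W (p : ℤ)), P ∈ C → resGal (K := K) L σ • P = P)
    (hC2 : ∀ (σ : absoluteGaloisGroup L) (P : geomTorsion W (p : ℤ)), resGal (K := K) L σ • P - P ∈ C)
    (κL : ZpExtension L p) (hκL : κL.IsCyclotomic) (hμ : ClassicalMuVanishes κL) :
    Set.Finite {c : W.subgroupH1 p (BaseChangeModel.galImage K L κL.kerSubgroup) |
      (∀ (𝔓 : Ideal (absIntegers (𝓞 K) K)), 𝔓.IsMaximal →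
        W.resOfLe p (inf_le_left : BaseChangeModel.galImage K L κL.kerSubgroup ⊓
          𝔓.decompositionSubgroup (absoluteGaloisGroup K) ≤ BaseChangeModel.galImage K L κL.kerSubgroup) c = 0) ∧
      p • c = 0} := by
  have hpr : p.Prime := Fact.out
  haveI hne : NeZero p := ⟨hpr.ne_zero⟩
  set WL : WeierstrassCurve L := W.baseChange L with hWL
  -- (1) `Sel₀(L_∞, E_L[p])` is finite: the dévissage over `L`
  have hfin : (GreenbergSelmer.fineSelmerInfty (↥(geomTorsion WL (p : ℤ))) κL :
      Set (subgroupH1 κL.kerSubgroup (geomTorsion WL (p : ℤ)))).Finite := by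
    haveI : Finite (geomTorsion WL (p : ℤ)) := WL.finite_geomTorsion_nat (NeZero.ne p)
    have hcard : ∃ k : ℕ, Nat.card (geomTorsion WL (p : ℤ)) = p ^ k :=
      ⟨2, WL.natCard_geomTorsion_eq_sq_of_charZero hpr⟩
    -- `E_L[p]` is unramified outside the places above `p` and the bad places
    have hSfin : ({v : HeightOneSpectrum (𝓞 L) | (p : 𝓞 L) ∈ v.asIdeal} ∪ WL.badPlaces (𝓞 L)).Finite := by
      refine Set.Finite.union ?_ (WL.finite_badPlaces_holds (𝓞 L))
      have hne' : Ideal.span {(p : 𝓞 L)} ≠ 0 := by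
        rw [Ideal.zero_eq_bot, Ne, Ideal.span_singleton_eq_bot]
        exact_mod_cast hpr.ne_zero
      refine (Ideal.finite_factors hne').subset fun v hv ↦ ?_
      simp only [Set.mem_setOf_eq] at hv ⊢
      exact Ideal.dvd_iff_le.mpr ((Ideal.span_singleton_le_iff_mem _).mpr hv)
    have hunr : ∀ v ∉ ({v : HeightOneSpectrum (𝓞 L) | (p : 𝓞 L) ∈ v.asIdeal} ∪ WL.badPlaces (𝓞 L)),
        ∀ 𝔓 ∈ v.primesAbove, ∀ σ ∈ 𝔓.inertia (absoluteGaloisGroup L),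
          ∀ m : geomTorsion WL (p : ℤ), σ • m = m := by
      intro v hv 𝔓 h𝔓 σ hσ m
      rw [Set.mem_union, not_or, Set.mem_setOf_eq, WeierstrassCurve.mem_badPlaces_iff, not_not] at hv
      exact WL.smul_geomTorsion_eq_of_mem_inertia hv.2 (n := (p : ℤ)) (by exact_mod_cast hv.1) h𝔓 hσ m
    -- the flag `C_L = e(C)`, `e : E[p] ≃ E_L[p]`
    set CL : AddSubgroup (geomTorsion WL (p : ℤ)) := C.map (torsionBaseChangeEquiv L W (p : ℤ)).toAddMonoidHom
      with hCL
    have hC1L : ∀ (τ : absoluteGaloisGroup L) (T : geomTorsion WL (p : ℤ)), T ∈ CL → τ • T = T := by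
      rintro τ _ ⟨P, hP, rfl⟩
      change τ • torsionBaseChangeEquiv L W (p : ℤ) P = torsionBaseChangeEquiv L W (p : ℤ) P
      rw [torsionBaseChangeEquiv_apply, ← torsionBaseChangeMap_smul, hC1 τ P hP]
    have hC2L : ∀ (τ : absoluteGaloisGroup L) (T : geomTorsion WL (p : ℤ)), τ • T - T ∈ CL := by
      intro τ T
      obtain ⟨P, rfl⟩ := (torsionBaseChangeEquiv L W (p : ℤ)).surjective T
      refine ⟨resGal (K := K) L τ • P - P, hC2 τ P, ?_⟩
      rw [AddEquiv.coe_toAddMonoidHom, map_sub, torsionBaseChangeEquiv_apply, torsionBaseChangeEquiv_apply,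
        torsionBaseChangeMap_smul]
    exact finite_fineSelmerInfty_of_unipotent_of_isTotallyComplex ⟨hL⟩ κL hκL hμ hcard _ hSfin hunr CL hC1L hC2L
  -- (2) `Sel₀(L_∞, E_L[p^∞])[p]` is finite
  have hfin2 : Set.Finite {s : WL.fineSelmerInfty κL | p • s = 0} :=
    FineSelmerCoefficientMap.finite_fineSelmerInfty_pTorsion_of_finite_torsion_of_forall_infinitePlace WL κL hκL
      (fun w y ↦ FineBaseChangeModel.subgroupH1_inf_decompInf_eq_zero_of_isComplex _ w (hL w) y) hfin
  -- (3) transport along the base-change model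
  refine (hfin2.image fun s : ↥(WL.fineSelmerInfty κL) ↦
    BaseChangeModel.subgroupModelIso K L κL.kerSubgroup W p (s : WL.subgroupH1 p κL.kerSubgroup)).subset ?_
  rintro c ⟨hc, hpc⟩
  set x := (BaseChangeModel.subgroupModelIso K L κL.kerSubgroup W p).symm c with hx
  have hΘx : BaseChangeModel.subgroupModelIso K L κL.kerSubgroup W p x = c := by
    rw [hx, AddEquiv.apply_symm_apply]
  have hxmem : x ∈ WL.fineSelmerInfty κL :=
    FineBaseChangeModel.mem_fineSelmerInfty_of_forall_prime_subgroupModelIso W κL hL x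
      (fun 𝔓 h𝔓 ↦ by
        haveI := h𝔓
        rw [hΘx]
        exact hc 𝔓 h𝔓)
  refine ⟨⟨x, hxmem⟩, ?_, hΘx⟩
  show p • (⟨x, hxmem⟩ : WL.fineSelmerInfty κL) = 0
  apply Subtype.ext
  simp only [AddSubgroupClass.coe_nsmul, ZeroMemClass.coe_zero]
  rw [hx, ← map_nsmul, hpc, map_zero]

end UpstairsUnipotent

end Literature.NumberTheory.EllipticCurves.FineSelmerUpstairs

end
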